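import Summits.ResolutionOfSingularities.ResolutionOfSingularities.Theorems.WeightedInvariantIota3EpsTopStratum
import Summits.ResolutionOfSingularities.ResolutionOfSingularities.Theorems.WeightedInvariantIotaOrderStratDimTwo
import Literature.AlgebraicGeometry.Resolution.RegularLocalHeights
import HarnessLib

/-!
# The regimes of a P3 position read off the top `(ν ; ε)`-stratum: curve centre / divisorial / point (isolated ⊔ crossing)
# — ORDER (o38) «REGIMES + P3d» of res-L1-w43-plan-1 (door `HypersurfaceCentreConstruction`, stmt-ResolutionOfSingularities-19897,
# KEY `stub_localWeightedDropEFT4S`, rung P3 `stub_keyRung_dimLEThree`)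

Topic: `Summits/ResolutionOfSingularities/ResolutionOfSingularities/Theorems`. Helper for the door item
`HypersurfaceCentreConstruction` (statement `stmt-ResolutionOfSingularities-19897`, route `WeightedInvariant`), line `local-engine`
of res-L1-w43-plan-1 (L W4.3), ORDER (o38) (DEALS gen 11 #1 (2), HOME/STATUS 2026-08-27T11:54:07Z), IOTA3-DESIGN v1.2 §2–§3.
Typer res-type-073. Inputs BY NAME: res-type-078's `Iota3.topStratumPrime_iotaOrdEps_spec` (p528738: at a P3 position
`P₀ := topStratumPrime iotaOrdEps S f` is PRIME, `S ⧸ P₀` regular, `f ∈ P₀ ^ ν`), `Iota3.iotaEps_eq_zero_of_ringKrullDim_le_two`,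
`Iota3.ringKrullDim_localization_le_two_of_ne`, `Iota3.isPermissibleEquimultipleLocus_localization` (…Iota3EpsStrat);
res-type-013's `Iota3.iotaEps` / `iotaOrdEps` / `topStratumPrime_spec_of_isPermissibleEquimultipleLocus` (p527087); res-type-005's
`ContactCylinder.topStratum` / `topStratumPrime` (p524206); the tree's `height_add_ringKrullDim_quotient` (RegularLocalHeights).

[OURS · L1 W4.3] Replaces the role of NO printed item; NOT a statement of the manuscript under review
(Hironaka 2017, [claim: Hironaka2017, status: under-review]). AI work, weaker than expert review. Definitions of the regime
predicates + their dichotomy theorems; nothing here asserts (drop) or any clause of the KEY.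

## What is typed / proved (S regular local, `ringKrullDim S ≤ 3`, `0 ≠ f ∈ 𝔪`; `P₀ := ContactCylinder.topStratumPrime iotaOrdEps S f`)

* `IsPointCentrePosition S f := P₀ = 𝔪`; `IsCurveCentrePosition S f := P₀ ≠ 𝔪 ∧ dim (S ⧸ P₀) = 1` (regime P3a);
  `IsDivisorialPosition S f := dim (S ⧸ P₀) = 2`; `IsIsolatedPosition S f := topStratum iotaOrd S f = V(𝔪)` (the equimultiple locus is
  the closed point: `ε = 0` with witness `𝔪`); `IsCrossingPosition S f := iotaEps S f = 1` (the equimultiple locus is not a permissible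
  centre).
* (R1) `point_or_curve_or_divisorial` (exhaustive), `not_point_and_curve` / `not_point_and_divisorial` / `not_curve_and_divisorial`
  (exclusive), `isPointCentrePosition_iff_isolated_or_crossing` and `not_isolated_and_crossing` (the point regime is the disjoint union
  of the isolated (P3b) and crossing (P3d) sub-regimes; crossing forces `P₀ = 𝔪` because `ε = 0` at every position of dimension ≤ 2).
* (R2) `exists_eq_unit_mul_pow_of_isDivisorialPosition` — a divisorial position is of MONOMIAL TYPE: `f = c·u^ν`, `c` a unit,
  `u ∈ 𝔪 ∖ 𝔪²`, `P₀ = (u)` (catenary count `ht P₀ = 1` ⇒ `P₀ = (u)` in the UFD `S`; `f ∈ P₀ ^ ν` with `ν = ord f` forces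
  `ord u = 1` and a unit cofactor) — so the centre is the smooth divisor `V(u)` with weight `1` and the successor conjunct of the game
  is vacuous there (the strict transform is a unit off the vertex; stated over res-type-061's `WeightedDrop` in the sequel (R3), with
  `Iota3.P3dDrop`, once (o33-b) is in the tree).

## References
* D. Abramovich, M. Temkin, J. Włodarczyk, *Functorial embedded resolution via weighted blowings up*, Algebra & Number Theory 18
  (2024), §5. [cite: AbramovichTemkinWlodarczyk2024, §5]
* H. Matsumura, *Commutative Ring Theory*, Thm. 17.4 / 17.9 (catenarity of Cohen–Macaulay rings), Thm. 20.3 (regular ⇒ UFD).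
  [cite: Matsumura1987, Thm. 20.3]
* res-L1-w43-plan-1 IOTA3-DESIGN v1.2; res-type-078 IOTA3-INPUT; res-type-073 IOTA3-PROBE (OURS, AI planning).
-/

noncomputable section

open IsLocalRing Literature.AlgebraicGeometry.Resolution
open Summit.ResolutionOfSingularities.ResolutionOfSingularities.Theorems

set_option linter.dupNamespace false -- mandated namespace of this single-conjunct summit

namespace Summit.ResolutionOfSingularities.ResolutionOfSingularities.Cruxes.HypersurfaceCentreConstruction.LocalEngine

namespace Iota3

variable (S : Type) [CommRing S]

/-! ## The regime predicates -/

/-- [OURS · (o38)] **Point-centre position**: the generic prime of the top `(ν ; ε)`-stratum is the maximal ideal (regimes P3b ⊔ P3d);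
a predicate of the line, not a cited statement. -/
def IsPointCentrePosition [IsLocalRing S] (f : S) : Prop :=
  ContactCylinder.topStratumPrime iotaOrdEps S f = maximalIdeal S

/-- [OURS · (o38)] **Curve-centre position** (regime P3a): the top `(ν ; ε)`-stratum is a curve, `P₀ ≠ 𝔪` and `dim (S ⧸ P₀) = 1`;
a predicate of the line, not a cited statement. -/
def IsCurveCentrePosition [IsLocalRing S] (f : S) : Prop :=
  ContactCylinder.topStratumPrime iotaOrdEps S f ≠ maximalIdeal S ∧
    ringKrullDim (S ⧸ ContactCylinder.topStratumPrime iotaOrdEps S f) = (1 : ℕ)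

/-- [OURS · (o38)] **Divisorial position**: the top `(ν ; ε)`-stratum is a surface, `dim (S ⧸ P₀) = 2` (at Krull dimension 3: `P₀` of
height one — the monomial-type case, (R2)); a predicate of the line, not a cited statement. -/
def IsDivisorialPosition [IsLocalRing S] (f : S) : Prop :=
  ringKrullDim (S ⧸ ContactCylinder.topStratumPrime iotaOrdEps S f) = (2 : ℕ)

/-- [OURS · (o38)] **Isolated position** (sub-regime P3b): the equimultiple locus of `f` (top `ν`-stratum) is the closed point alone,
`topStratum iotaOrd S f = V(𝔪)` — so `ε = 0` with witness `𝔪`; a predicate of the line, not a cited statement. -/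
def IsIsolatedPosition [IsLocalRing S] (f : S) : Prop :=
  ContactCylinder.topStratum iotaOrd S f = {𝔮 | maximalIdeal S ≤ 𝔮.asIdeal}

/-- [OURS · (o38)] **Crossing position** (sub-regime P3d): the equimultiple locus is NOT a permissible centre, `ε(S, f) = 1`
(res-type-013's `Iota3.iotaEps`); a predicate of the line, not a cited statement. -/
def IsCrossingPosition (f : S) : Prop :=
  iotaEps S f = 1

variable {S}

/-! ## (R1) The regimes are exhaustive and pairwise exclusive at Krull dimension ≤ 3 -/

/-- Cast bookkeeping: `⊤ + d ≠ n` in `WithBot ℕ∞` for naturals `d, n`. [folklore] -/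
theorem top_add_natCast_ne_natCast (d n : ℕ) : ((⊤ : ℕ∞) : WithBot ℕ∞) + (d : WithBot ℕ∞) ≠ (n : WithBot ℕ∞) := by
  intro h
  have h' : (((⊤ : ℕ∞) + (d : ℕ∞) : ℕ∞) : WithBot ℕ∞) = ((n : ℕ∞) : WithBot ℕ∞) := by
    rw [WithBot.coe_add]; exact_mod_cast h
  rw [WithBot.coe_inj, top_add] at h'
  exact ENat.top_ne_coe n h'

section Regimes

variable [IsRegularLocalRing S]

/-- `dim (S ⧸ P₀) ≤ 2` at a P3 position: `P₀ ∋ f ≠ 0` has height ≥ 1 and `S` is catenary (`ht P₀ + dim S⧸P₀ = dim S ≤ 3`).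
[cite: Matsumura1987, Thm. 17.9] -/
theorem ringKrullDim_quotient_topStratumPrime_le_two (hdim : ringKrullDim S ≤ 3) {f : S} (hf0 : f ≠ 0)
    (hf : f ∈ maximalIdeal S) :
    ringKrullDim (S ⧸ ContactCylinder.topStratumPrime iotaOrdEps S f) ≤ 2 := by
  haveI := isDomain_of_isRegularLocalRing S
  obtain ⟨hP, -, hfP, -⟩ := topStratumPrime_iotaOrdEps_spec hdim hf0 hf (ν := (adicOrder f).toNat)
    (by rw [iotaOrd_eq_ordOfENat_adicOrder, ← ordOfENat_natCast, ENat.coe_toNat (adicOrder_ne_top hf0)])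
  haveI := hP
  set P := ContactCylinder.topStratumPrime iotaOrdEps S f
  have hadd := height_add_ringKrullDim_quotient (S := S) P
  have hPbot : P ≠ ⊥ := fun h => hf0 (by simpa [h] using hfP)
  have hht : 1 ≤ P.height := by
    rw [Order.one_le_iff_pos, pos_iff_ne_zero, Ne, Ideal.height_eq_zero_iff_eq_bot]
    exact hPbot
  haveI : Nontrivial (S ⧸ P) := Ideal.Quotient.nontrivial_iff.mpr hP.ne_top
  haveI : IsLocalRing (S ⧸ P) := IsLocalRing.of_surjective' (Ideal.Quotient.mk P) Ideal.Quotient.mk_surjective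
  obtain ⟨d, hd⟩ := exists_ringKrullDim_eq_natCast (S ⧸ P)
  obtain ⟨n, hn⟩ := exists_ringKrullDim_eq_natCast S
  rw [hd, hn] at hadd
  rw [hd]
  have hn3 : n ≤ 3 := by rw [hn] at hdim; exact_mod_cast hdim
  -- `P.height` is finite (bounded by `dim S`)
  have hfin : P.height ≠ ⊤ := by
    intro htop
    rw [htop] at hadd
    exact top_add_natCast_ne_natCast d n hadd
  obtain ⟨h, hh⟩ := ENat.ne_top_iff_exists.mp hfin
  rw [← hh] at hadd hht
  have hsum : h + d = n := by
    have : ((h : ℕ∞) : WithBot ℕ∞) + ((d : ℕ∞) : WithBot ℕ∞) = ((n : ℕ∞) : WithBot ℕ∞) := hadd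
    exact_mod_cast this
  have h1 : 1 ≤ h := by exact_mod_cast hht
  exact_mod_cast (show d ≤ 2 by omega)

/-- **(R1) exhaustive**: every P3 position is point-centre, curve-centre or divisorial. [OURS · (o38), kernel bookkeeping] -/
theorem point_or_curve_or_divisorial (hdim : ringKrullDim S ≤ 3) {f : S} (hf0 : f ≠ 0) (hf : f ∈ maximalIdeal S) :
    IsPointCentrePosition S f ∨ IsCurveCentrePosition S f ∨ IsDivisorialPosition S f := by
  haveI := isDomain_of_isRegularLocalRing S
  obtain ⟨hP, hreg, -, -⟩ := topStratumPrime_iotaOrdEps_spec hdim hf0 hf (ν := (adicOrder f).toNat)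
    (by rw [iotaOrd_eq_ordOfENat_adicOrder, ← ordOfENat_natCast, ENat.coe_toNat (adicOrder_ne_top hf0)])
  haveI := hP
  set P := ContactCylinder.topStratumPrime iotaOrdEps S f with hPdef
  by_cases hpt : P = maximalIdeal S
  · exact Or.inl hpt
  right
  have hle2 := ringKrullDim_quotient_topStratumPrime_le_two hdim hf0 hf
  rw [← hPdef] at hle2
  haveI : Nontrivial (S ⧸ P) := Ideal.Quotient.nontrivial_iff.mpr hP.ne_top
  haveI : IsLocalRing (S ⧸ P) := IsLocalRing.of_surjective' (Ideal.Quotient.mk P) Ideal.Quotient.mk_surjective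
  obtain ⟨d, hd⟩ := exists_ringKrullDim_eq_natCast (S ⧸ P)
  -- `d ≠ 0`: a regular local ring of dimension `0` is a field, i.e. `P` would be maximal
  have hd0 : d ≠ 0 := by
    intro hd0
    apply hpt
    haveI := hreg
    have hsf := hreg.spanFinrank_maximalIdeal
    rw [hd, hd0] at hsf
    have hsf0 : (maximalIdeal (S ⧸ P)).spanFinrank = 0 := by exact_mod_cast hsf
    have hbot : maximalIdeal (S ⧸ P) = ⊥ :=
      Submodule.spanFinrank_eq_zero_iff_eq_bot (IsNoetherian.noetherian _) |>.mp hsf0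
    rw [maximalIdeal_quotient_eq_map P, Ideal.map_eq_bot_iff_le_ker, Ideal.mk_ker] at hbot
    exact le_antisymm (IsLocalRing.le_maximalIdeal hP.ne_top) hbot
  rw [hd] at hle2
  have hd2 : d ≤ 2 := by exact_mod_cast hle2
  rcases Nat.lt_or_ge d 2 with hlt | hge
  · left
    exact ⟨hpt, by rw [hd]; exact_mod_cast (show d = 1 by omega)⟩
  · right
    show ringKrullDim (S ⧸ P) = (2 : ℕ)
    rw [hd]; exact_mod_cast (show d = 2 by omega)

omit [IsRegularLocalRing S] in
/-- **(R1) exclusive**: point-centre vs curve-centre. [OURS · (o38)] -/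
theorem not_point_and_curve [IsLocalRing S] (f : S) : ¬ (IsPointCentrePosition S f ∧ IsCurveCentrePosition S f) :=
  fun ⟨h1, h2⟩ => h2.1 h1

/-- **(R1) exclusive**: point-centre vs divisorial (`dim S⧸𝔪 = 0 ≠ 2`). [OURS · (o38)] -/
theorem not_point_and_divisorial (f : S) : ¬ (IsPointCentrePosition S f ∧ IsDivisorialPosition S f) := by
  rintro ⟨h1, h2⟩
  unfold IsDivisorialPosition at h2
  unfold IsPointCentrePosition at h1
  rw [h1] at h2
  haveI : IsField (S ⧸ maximalIdeal S) := Ideal.Quotient.maximal_ideal_iff_isField_quotient _ |>.mp inferInstance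
  have h0 := ringKrullDim_eq_zero_of_isField ‹IsField (S ⧸ maximalIdeal S)›
  rw [h0] at h2
  exact absurd h2 (by norm_cast)

omit [IsRegularLocalRing S] in
/-- **(R1) exclusive**: curve-centre vs divisorial (`1 ≠ 2`). [OURS · (o38)] -/
theorem not_curve_and_divisorial [IsLocalRing S] (f : S) : ¬ (IsCurveCentrePosition S f ∧ IsDivisorialPosition S f) := by
  rintro ⟨⟨-, h1⟩, h2⟩
  unfold IsDivisorialPosition at h2
  rw [h1] at h2
  exact absurd h2 (by norm_cast)

/-! ### The point regime = isolated ⊔ crossing -/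

/-- An isolated position has `ε = 0` (witness `P = 𝔪`: `S ⧸ 𝔪` is a field, hence regular). [OURS · (o38)] -/
theorem iotaEps_eq_zero_of_isIsolatedPosition {f : S} (h : IsIsolatedPosition S f) : iotaEps S f = 0 := by
  rw [iotaEps_eq_zero_iff]
  refine ⟨maximalIdeal S, inferInstance, ?_, h⟩
  haveI : IsField (S ⧸ maximalIdeal S) := Ideal.Quotient.maximal_ideal_iff_isField_quotient _ |>.mp inferInstance
  letI := ‹IsField (S ⧸ maximalIdeal S)›.toField
  infer_instance

/-- **(R1)** isolated and crossing exclude each other (`ε = 0` vs `ε = 1`). [OURS · (o38)] -/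
theorem not_isolated_and_crossing (f : S) : ¬ (IsIsolatedPosition S f ∧ IsCrossingPosition S f) := by
  rintro ⟨h1, h2⟩
  have h0 := iotaEps_eq_zero_of_isIsolatedPosition h1
  unfold IsCrossingPosition at h2
  rw [h0] at h2
  exact zero_ne_one h2

/-- When `ε(S, f) = 0`, the top `(ν ; ε)`-stratum IS the top `ν`-stratum (permissibility localises along it, res-type-078's
`isPermissibleEquimultipleLocus_localization`). [OURS · (o38)] -/
theorem topStratum_iotaOrdEps_eq_topStratum_iotaOrd_of_iotaEps_eq_zero {f : S} (hf : f ∈ maximalIdeal S)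
    (h0 : iotaEps S f = 0) :
    ContactCylinder.topStratum iotaOrdEps S f = ContactCylinder.topStratum iotaOrd S f := by
  ext 𝔮
  rw [ContactCylinder.mem_topStratum_iff, ContactCylinder.mem_topStratum_iff, iotaOrdEps_eq_iff]
  constructor
  · exact fun h => h.1
  · intro heq
    refine ⟨heq, ?_⟩
    have hperm : IsPermissibleEquimultipleLocus S f := (iotaEps_eq_zero_iff S f).mp h0
    have hf𝔮 : f ∈ 𝔮.asIdeal :=
      mem_asIdeal_of_mem_topStratum_iotaOrd S hf ((ContactCylinder.mem_topStratum_iff iotaOrd S f 𝔮).mpr heq)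
    haveI := 𝔮.isPrime
    rw [h0, iotaEps_eq_zero_iff]
    exact isPermissibleEquimultipleLocus_localization hf hperm 𝔮.asIdeal hf𝔮 heq

/-- An isolated position is a point-centre position (`P₀ = 𝔪`). [OURS · (o38)] -/
theorem isPointCentrePosition_of_isIsolatedPosition {f : S} (hf : f ∈ maximalIdeal S) (h : IsIsolatedPosition S f) :
    IsPointCentrePosition S f := by
  have h0 := iotaEps_eq_zero_of_isIsolatedPosition h
  have hS : ContactCylinder.topStratum iotaOrdEps S f = {𝔮 | maximalIdeal S ≤ 𝔮.asIdeal} := by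
    rw [topStratum_iotaOrdEps_eq_topStratum_iotaOrd_of_iotaEps_eq_zero hf h0]; exact h
  exact ContactCylinder.topStratumPrime_eq_of_topStratum_eq iotaOrdEps S f hS

/-- A crossing position (`ε = 1`) is a point-centre position at Krull dimension ≤ 3: the generic point `P₀` of the top
`(ν ; ε)`-stratum keeps `ε = 1`, but `ε = 0` at every position of dimension ≤ 2 (res-type-078's
`iotaEps_eq_zero_of_ringKrullDim_le_two` / `ringKrullDim_localization_le_two_of_ne`), so `P₀ = 𝔪`. [OURS · (o38)] -/
theorem isPointCentrePosition_of_isCrossingPosition (hdim : ringKrullDim S ≤ 3) {f : S} (hf0 : f ≠ 0)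
    (hf : f ∈ maximalIdeal S) (h : IsCrossingPosition S f) : IsPointCentrePosition S f := by
  haveI := isDomain_of_isRegularLocalRing S
  obtain ⟨hP, -, hfP, -, hiff, -⟩ := topStratumPrime_iotaOrdEps_spec hdim hf0 hf (ν := (adicOrder f).toNat)
    (by rw [iotaOrd_eq_ordOfENat_adicOrder, ← ordOfENat_natCast, ENat.coe_toNat (adicOrder_ne_top hf0)])
  haveI := hP
  set P := ContactCylinder.topStratumPrime iotaOrdEps S f with hPdef
  by_contra hne
  have hkept := (hiff P hfP).mpr le_rfl
  rw [iotaOrdEps_eq_iff] at hkept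
  have hdim2 : ringKrullDim (Localization.AtPrime P) ≤ 2 := ringKrullDim_localization_le_two_of_ne hdim P hne
  haveI : IsRegularLocalRing (Localization.AtPrime P) := isRegularLocalRing_localization_atPrime S P
  have hinj : Function.Injective (algebraMap S (Localization.AtPrime P)) :=
    IsLocalization.injective (Localization.AtPrime P) P.primeCompl_le_nonZeroDivisors
  have hf0' : algebraMap S (Localization.AtPrime P) f ≠ 0 := fun h0 => hf0 (hinj (by rw [h0, map_zero]))
  have hf' : algebraMap S (Localization.AtPrime P) f ∈ maximalIdeal (Localization.AtPrime P) := by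
    rw [← Localization.AtPrime.map_eq_maximalIdeal]; exact Ideal.mem_map_of_mem _ hfP
  have hε0 := iotaEps_eq_zero_of_ringKrullDim_le_two hdim2 hf0' hf'
  unfold IsCrossingPosition at h
  rw [hkept.2, h] at hε0
  exact one_ne_zero hε0

/-- **(R1) the point regime is the disjoint union of the isolated and the crossing sub-regimes** (at Krull dimension ≤ 3,
`0 ≠ f ∈ 𝔪`). [OURS · (o38), kernel bookkeeping] -/
theorem isPointCentrePosition_iff_isolated_or_crossing (hdim : ringKrullDim S ≤ 3) {f : S} (hf0 : f ≠ 0)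
    (hf : f ∈ maximalIdeal S) :
    IsPointCentrePosition S f ↔ IsIsolatedPosition S f ∨ IsCrossingPosition S f := by
  refine ⟨fun hpt => ?_, fun h => h.elim (isPointCentrePosition_of_isIsolatedPosition hf)
    (isPointCentrePosition_of_isCrossingPosition hdim hf0 hf)⟩
  rcases iotaEps_eq_zero_or_eq_one S f with h0 | h1
  · left
    -- `ε = 0`: the two top strata agree, so `topStratum iotaOrd = V(P₀) = V(𝔪)`
    obtain ⟨hP, -, -, hS, -⟩ := topStratumPrime_iotaOrdEps_spec hdim hf0 hf (ν := (adicOrder f).toNat)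
      (by rw [iotaOrd_eq_ordOfENat_adicOrder, ← ordOfENat_natCast, ENat.coe_toNat (adicOrder_ne_top hf0)])
    unfold IsIsolatedPosition
    rw [← topStratum_iotaOrdEps_eq_topStratum_iotaOrd_of_iotaEps_eq_zero hf h0, hS]
    unfold IsPointCentrePosition at hpt
    rw [hpt]
  · exact Or.inr h1

end Regimes

/-! ## (R2) A divisorial position is of monomial type -/

section Divisorial

variable [IsRegularLocalRing S]

/-- **(R2) divisorial ⇒ monomial type.** At a P3 position whose top `(ν ; ε)`-stratum is a surface (`dim S⧸P₀ = 2`, Krull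
dimension of `S` at most `3`), `P₀` has height one, so `P₀ = (u)` for a prime element `u` of the UFD `S`; since `f ∈ P₀ ^ ν` with
`ν = ord f` (the order is kept along `V(P₀)`, res-type-078 p528738/p524107), `f = c·u^ν` with `ord u = 1` and `c` a unit. Hence the
centre of the game is the smooth divisor `V(u)` (weight `1`) and its successor conjunct is vacuous (R3, sequel).
[cite: Matsumura1987, Thm. 20.3] -/
theorem exists_eq_unit_mul_pow_of_isDivisorialPosition (hdim : ringKrullDim S ≤ 3) {f : S} (hf0 : f ≠ 0)
    (hf : f ∈ maximalIdeal S) (h : IsDivisorialPosition S f) :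
    ∃ (c u : S), IsUnit c ∧ u ∈ maximalIdeal S ∧ u ∉ maximalIdeal S ^ 2 ∧
      f = c * u ^ (adicOrder f).toNat ∧ ContactCylinder.topStratumPrime iotaOrdEps S f = Ideal.span {u} := by
  classical
  haveI := isDomain_of_isRegularLocalRing S
  haveI : UniqueFactorizationMonoid S := IsRegularLocalRing.uniqueFactorizationMonoid S
  set ν := (adicOrder f).toNat with hνdef
  have hν : iotaOrd S f = ν := by
    rw [iotaOrd_eq_ordOfENat_adicOrder, ← ordOfENat_natCast, ENat.coe_toNat (adicOrder_ne_top hf0)]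
  obtain ⟨hP, -, hfP, -, -, hfPν⟩ := topStratumPrime_iotaOrdEps_spec hdim hf0 hf hν
  haveI := hP
  set P := ContactCylinder.topStratumPrime iotaOrdEps S f with hPdef
  -- height one by catenarity: `ht P + 2 = dim S ≤ 3`, `ht P ≥ 1`
  have hPbot : P ≠ ⊥ := fun h0 => hf0 (by simpa [h0] using hfP)
  have hadd := height_add_ringKrullDim_quotient (S := S) P
  unfold IsDivisorialPosition at h
  rw [← hPdef] at h
  rw [h] at hadd
  obtain ⟨n, hn⟩ := exists_ringKrullDim_eq_natCast S
  rw [hn] at hadd hdim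
  have hn3 : n ≤ 3 := by exact_mod_cast hdim
  have hfin : P.height ≠ ⊤ := by
    intro htop; rw [htop] at hadd; exact top_add_natCast_ne_natCast 2 n hadd
  obtain ⟨ht, hht⟩ := ENat.ne_top_iff_exists.mp hfin
  rw [← hht] at hadd
  have hsum : ht + 2 = n := by
    have : ((ht : ℕ∞) : WithBot ℕ∞) + (((2 : ℕ) : ℕ∞) : WithBot ℕ∞) = ((n : ℕ∞) : WithBot ℕ∞) := hadd
    exact_mod_cast this
  have hht0 : P.height ≠ 0 := by rw [Ne, Ideal.height_eq_zero_iff_eq_bot]; exact hPbot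
  have hheight : P.height = 1 := by
    rw [← hht] at hht0 ⊢
    have : ht ≠ 0 := by exact_mod_cast hht0
    exact_mod_cast (show ht = 1 by omega)
  -- `P = (u)` for a prime element `u`
  obtain ⟨u, huP, hu⟩ := Ideal.IsPrime.exists_mem_prime_of_ne_bot hP hPbot
  have hPu : P = Ideal.span {u} := Ideal.eq_span_singleton_of_height_eq_one hheight huP hu
  have hu𝔪 : u ∈ maximalIdeal S := (IsLocalRing.le_maximalIdeal hP.ne_top) huP
  -- `f ∈ P ^ ν = (u ^ ν)`: `f = c · u ^ ν`
  rw [hPu, Ideal.span_singleton_pow, Ideal.mem_span_singleton] at hfPν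
  obtain ⟨c, hc⟩ := hfPν
  -- order count: `ord f = ν · ord u + ord c`, so `ord u = 1` and `ord c = 0`
  have hν1 : 1 ≤ ν := by
    have h1 : ((1 : ℕ) : ℕ∞) ≤ adicOrder f := (le_adicOrder_iff f 1).mpr (by rwa [pow_one])
    rw [← ENat.coe_toNat (adicOrder_ne_top hf0)] at h1
    exact_mod_cast h1
  obtain ⟨a, ha⟩ := ENat.ne_top_iff_exists.mp (adicOrder_ne_top hu.ne_zero)
  have hc0 : c ≠ 0 := by rintro rfl; exact hf0 (by rw [hc, mul_zero])
  obtain ⟨b, hb⟩ := ENat.ne_top_iff_exists.mp (adicOrder_ne_top hc0)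
  have hord : adicOrder f = ν * adicOrder u + adicOrder c := by rw [hc, adicOrder_mul, adicOrder_pow]
  rw [← ha, ← hb] at hord
  have hνeq : (ν : ℕ∞) = adicOrder f := (ENat.coe_toNat (adicOrder_ne_top hf0)).symm ▸ rfl
  rw [← hνeq] at hord
  have hord' : ν = ν * a + b := by exact_mod_cast hord
  have ha1 : 1 ≤ a := by
    have : ((1 : ℕ) : ℕ∞) ≤ adicOrder u := (le_adicOrder_iff u 1).mpr (by rwa [pow_one])
    rw [← ha] at this; exact_mod_cast this
  have hb0 : b = 0 := by nlinarith
  have ha' : a = 1 := by nlinarith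
  have hu2 : u ∉ maximalIdeal S ^ 2 := by
    rw [← le_adicOrder_iff u 2, ← ha, ha']; norm_num
  have hcu : IsUnit c := by
    by_contra hnu
    have hcm : c ∈ maximalIdeal S := (IsLocalRing.mem_maximalIdeal c).mpr (mem_nonunits_iff.mpr hnu)
    have : ((1 : ℕ) : ℕ∞) ≤ adicOrder c := (le_adicOrder_iff c 1).mpr (by rwa [pow_one])
    rw [← hb, hb0] at this
    exact absurd (by exact_mod_cast this : (1 : ℕ) ≤ 0) (by omega)
  exact ⟨c, u, hcu, hu𝔪, hu2, by rw [hc, mul_comm], hPu⟩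

/-- Hence a divisorial position is of MONOMIAL TYPE in the sense of res-type-092's `IsMonomialType` (p514802) — the P2 CASE A one
dimension up. [OURS · (o38)] -/
theorem isMonomialType_of_isDivisorialPosition (hdim : ringKrullDim S ≤ 3) {f : S} (hf0 : f ≠ 0) (hf : f ∈ maximalIdeal S)
    (h : IsDivisorialPosition S f) : IsMonomialType f := by
  obtain ⟨c, u, hc, hu, hu2, hfac, -⟩ := exists_eq_unit_mul_pow_of_isDivisorialPosition hdim hf0 hf h
  exact ⟨c, u, (adicOrder f).toNat, hc, hu, hu2, hfac⟩

end Divisorial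

end Iota3

end Summit.ResolutionOfSingularities.ResolutionOfSingularities.Cruxes.HypersurfaceCentreConstruction.LocalEngine

end
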